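import Literature.MathematicalPhysics.QuantumFieldTheory.Balaban1983to89.B9B8KnitColumnFlatness
import Literature.MathematicalPhysics.QuantumFieldTheory.Balaban1983to89.B9Eq332FieldAvgCovariance
import Literature.MathematicalPhysics.QuantumFieldTheory.Balaban1983to89.B8Eq115GaugeFixing

/-!
# `Balaban1983to89.B9B8KnitColumnGauge` — the (B)-line bond junction, file F2: THE COLUMNS OF THE KNIT'S COMPOSITE AVERAGING AT A CURVED
# BACKGROUND ARE THE FLAT COLUMNS OF THE CORNER-TRANSPORTED VALUE, UP TO `C(d,L)·α₀·Lⁿ·L^{−nd}` — [Balaban1985Averaging] (139)–(147) read column by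
# column through the exact gauge covariance (3.32) of [Balaban1985BackgroundPropagators] and the axial gauge of [5] p. 24, on `ℤ^{d}`

statement-level skeleton of published theorems with citation tags; proofs where landed; nothing here is a claim about the
Yang–Mills mass gap

Sub-row G-B8-T2S (unit `lit-balaban-t2s-1`, gen 8), RULING #10 road, crux (c′): hypothesis (H1) (and the row form behind (H2)) of
`B9B8KnitAveragingClosenessOfColumns.norm_QsY_aY_QY_sub_QQZdP_le_of_columns_sharp`, on the `ℤᵈ` side (the torus ∕ def-Y identification is file F3).
MECHANISM.  For a unitary `U₀` in print's class (1.7) up to level `n` (`Reg17 L n ℤᵈ α`) and a level-`n` bond `c = (w, κ)` with double box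
`B = [Lⁿw, Lⁿw + (Lⁿ−1)𝟙 + Lⁿe_κ]` and corner `x₀ = Lⁿw`: (i) clamp `U₀` to `B` (`B7Prop1Local.clampCfg`; the column is local, the clamped field is
GLOBALLY `αL^{−2n}`-regular); (ii) pass to the axial gauge `u(x) = U₁(Γ^{tree}_{x₀,x})` of [5] p. 24 (`B7Prop1Explicit.axialFn`,
`axial_bond_bound`: `‖U₁^u(b) − 1‖ ≤ |b₋ − x₀|₁·αL^{−2n} ≤ (d+1)αL^{−n}` on `B`), in which, by the EXACT covariance
`B9Eq332FieldAvgCovariance.linCovIter_rot` and `u(x₀) = 1`, the column of `LⁿQ_n(U₁)` at the bump `X·δ_{(y,μ)}` IS the column of `LⁿQ_n(U₁^u)` at the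
ROTATED bump `R(u(y))X·δ_{(y,μ)}`; (iii) clamp again and apply file F1's flatness estimate (`B9B8KnitColumnFlatness.norm_linCovIter_bump_sub_linQIter_le`,
`ρ = (d+1)αL^{−n}` so `Lⁿρ = (d+1)α`).  Upshot: the knit's column transports the fine value at `y` to the CORNER `x₀` of the coarse double box along
the tree contour `Γ^{tree}_{x₀,y}` and is otherwise flat up to `C(d,L)·α·Lⁿ·L^{−nd}`.  The ROW form (§3) follows by additivity of the composite at the
clamped background (`B7Prop5LineDerivFiniteFamily.linCovIter_family`, `hadd_levels` ∕ `hsmul_levels`) over the `≤ 2d·L^{nd}` bonds of the box.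
Print: [5] (11) p. 19, p. 24–25, (122)–(127) pp. 36–37, (139)–(147) pp. 39–40; [4] (3.28), (3.32) p. 395; [B8] (1.7) p. 77.

WHAT IS PROVED (kernel, 0 sorry; theorems only, no `def`, no `… : Prop` fact, no `instance`).
* §1 locality ∕ clamp ∕ gauge toolkit: `linCovIter_congr'` (locality of the composite, public twin), `clamp_regular` (the clamped field is unitary,
  globally `αL^{−2n}`-regular, agrees on the box), `l1_sub_le_of_inBox`, `rotate_bump`, `norm_conjR_le_of_unitary` (constants spelled inline).
* §2 ★★★ `norm_linCovIter_bump_sub_linQIter_rot_le` — THE COLUMN THEOREM: for `L ≥ 2`, `d ≥ 1`, `0 < α ≤ α_Q(d,L)`, `U₀` unitary in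
  `Reg17 L n ℤᵈ α`, every level-`n` bond `(w, κ)`, fine bond `(y, μ)` and `X`:
  `‖LⁿQ_n(U₀)(X·δ_{(y,μ)})(w,κ) − LⁿQ_n(1)(R(U₀(Γ^{tree}_{Lⁿw,y}))X·δ_{(y,μ)})(w,κ)‖ ≤ K(d,L)·α·Lⁿ·L^{−nd}·‖X‖`,
  `K(d,L) = 4d·L^d·(3200(d+1)²(d+4)L³ + 128d²(d+1)L³L^{−(d+1)} + 8d(d+1)²L³L^{−(d+1)})`.
* §3 ★★ `norm_linCovIter_sub_sum_linQIter_rot_le` — THE ROW THEOREM: for a bond field `B` with `‖B(b)‖ ≤ b` on the box,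
  `‖LⁿQ_n(U₀)B(w,κ) − Σ_{b ⊂ B} LⁿQ_n(1)(R(U₀(Γ^{tree}_{x₀,b₋}))B(b)·δ_b)(w,κ)‖ ≤ 2d·K(d,L)·α·Lⁿ·b`.

HONEST SCOPE.  `ℤᵈ` statements about [5]'s composite linear averaging; the def-Y side (torus charts, `qK`, `parB`) is NOT here (file F3);
count-neutral; nothing continuum ∕ ℝ⁴ ∕ OS ∕ mass gap ∕ Clay — the Yang–Mills mass gap is NOT proved here.  NEW file; F1, [5]'s files,
`B9Eq332FieldAvgCovariance`, `B8Eq115GaugeFixing`, `B9Eq316AveragingTransposeZd` are used BY NAME, nothing landed is modified.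
-/

noncomputable section

namespace Literature.MathematicalPhysics.QuantumFieldTheory.Balaban1983to89.B9B8KnitColumnGauge

open scoped BigOperators
open B7Prop1Explicit renaming Site → LSite
open B7Prop1Explicit hiding Site
open B7Prop1Local (InBox AgreeOn loK bondHiK bondHi avgIter_congr add_e_apply clampCfg clampCfg_agree clampCfg_mem pdev_clampCfg_le
  clamp clamp_inBox hol_treeWord_congr pdevOn)
open B7Prop2Explicit (pdev avgIter unitaryUnits avgClosed_unitaryUnits le_pdev pdev_nonneg C0 c2' C0_pos hol_plaqWord_self)
open B7Prop3Flat (linQ)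
open B7Prop3GeneralRotated (norm_conjR_le)
open B7Prop3GeneralLinear (linQcov)
open B7Prop4Flat (linQIter)
open B7Prop4GeneralLevels (linCovIter linCovIter_succ linCovIter_zero)
open B7Prop5Flat (bump norm_bump_le BondIn inBox_nest bump_eq_zero_of bondsIn mem_bondsIn restr boxFinset mem_boxFinset
  agreeOn_insCfg_restr insCfg_restr_of_mem)
open B7Prop3Flat (insCfg)
open B7Prop5FlatOperator (card_boxFinset_K card_bondsIn_le)
open B7Prop5GeneralLevels (hadd_levels hsmul_levels)
open B7Prop5LineDerivFiniteFamily (linCovIter_family)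
open B7Eq78Linearization (conjR conjR_apply)
open B7AvgGaugeCovariance (uLev uLev_apply pdev_gaugeAct)
open B8Eq115GaugeFixing (gaugeAct_mem_of)
open B8Ineq132 (plaqF pdevOn_lt_of_forall)
open B9Eq316AveragingTransposeZd (alphaQ alphaQ_pos C0_mul_alphaQ_le four_mul_alphaQ_le Reg17)
open B9Eq332FieldAvgCovariance (linCovIter_rot)
open B9B8KnitColumnFlatness (norm_linCovIter_bump_sub_linQIter_le linCovIter_bump_eq_zero_of_not_inBox linCovIter_zero_field
  linQIter_finset_sum windows_of_alphaQ)
open B9B8KnitBondAvgDictionary (linCovIter_one_eq_linQIter)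

variable {D : ℕ} {𝔸 : Type} [CStarAlgebra 𝔸]

/-! ## §1 Locality, clamping, the axial gauge -/

section Toolkit

variable (L : ℕ)

/-- locality of the one-step linear part (122), jointly in `(V₀, A)` (private twin of the lineage's lemma). [cite: Balaban1985Averaging, (122) p.36, p.24] -/
private theorem linQcov_congr (hL : 1 ≤ L) (q : LSite D) (κ : Fin D) {V₀ V₀' : LSite D → Fin D → 𝔸ˣ}
    {A A' : LSite D → Fin D → 𝔸} (h₀ : AgreeOn q (bondHi L q κ) V₀ V₀') (hA : AgreeOn q (bondHi L q κ) A A') :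
    linQcov L V₀ A q κ = linQcov L V₀' A' q κ := by
  unfold linQcov
  congr 1
  funext t
  exact B7LocalityGeneral.Qcov_congr L hL q κ h₀ fun x μ hx hxe => by
    show t • A x μ = t • A' x μ
    rw [hA x μ hx hxe]

/-- **LOCALITY OF THE COMPOSITE `LʲQ_j(U₀)A(c)`** in the bonds of `Bʲ(c₋) ∪ Bʲ(c₊)`, jointly in `(U₀, A)` (public twin of the lineage's private lemma).
[cite: Balaban1985Averaging, p.24 (after (43)), p.38 (before (133))] -/
theorem linCovIter_congr' (hL : 1 ≤ L) :
    ∀ (j : ℕ) {U₀ U₀' : LSite D → Fin D → 𝔸ˣ} {B B' : LSite D → Fin D → 𝔸} (z : LSite D) (κ : Fin D),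
      AgreeOn (loK L j z) (bondHiK L j z κ) U₀ U₀' → AgreeOn (loK L j z) (bondHiK L j z κ) B B' →
        linCovIter L U₀ B j z κ = linCovIter L U₀' B' j z κ
  | 0, U₀, U₀', B, B', z, κ, _, h => by
    refine h z κ (fun i => ?_) (fun i => ?_)
    · simp only [loK, bondHiK, pow_zero, one_mul]; split_ifs <;> omega
    · simp only [loK, bondHiK, pow_zero, one_mul, add_e_apply]; split_ifs <;> omega
  | j + 1, U₀, U₀', B, B', z, κ, h₀, h => by
    rw [linCovIter_succ, linCovIter_succ]
    refine linQcov_congr L hL _ κ (fun x μ hx hxe => ?_) (fun x μ hx hxe => ?_)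
    · exact avgIter_congr L hL j x μ fun p ν hp hpν =>
        h₀ p ν (inBox_nest L j z κ ⟨hx, hxe⟩ hp) (inBox_nest L j z κ ⟨hx, hxe⟩ hpν)
    · exact linCovIter_congr' hL j x μ
        (fun p ν hp hpν => h₀ p ν (inBox_nest L j z κ ⟨hx, hxe⟩ hp) (inBox_nest L j z κ ⟨hx, hxe⟩ hpν))
        (fun p ν hp hpν => h p ν (inBox_nest L j z κ ⟨hx, hxe⟩ hp) (inBox_nest L j z κ ⟨hx, hxe⟩ hpν))

omit [CStarAlgebra 𝔸] in
/-- the double box is a genuine box: `loK ≤ bondHiK` coordinatewise (`L ≥ 1`). [folklore] -/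
private theorem loK_le_bondHiK (hL : 1 ≤ L) (j : ℕ) (z : LSite D) (κ : Fin D) (i : Fin D) : loK L j z i ≤ bondHiK L j z κ i := by
  have hP : (1 : ℤ) ≤ (L : ℤ) ^ j := one_le_pow₀ (by exact_mod_cast hL)
  simp only [loK, bondHiK]
  split_ifs <;> omega

omit [CStarAlgebra 𝔸] in
/-- the corner `x₀ = Lʲz` lies in the double box. [folklore] -/
private theorem loK_inBox (hL : 1 ≤ L) (j : ℕ) (z : LSite D) (κ : Fin D) : InBox (loK L j z) (bondHiK L j z κ) (loK L j z) :=
  fun i => ⟨le_rfl, loK_le_bondHiK L hL j z κ i⟩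

omit [CStarAlgebra 𝔸] in
/-- the corner as a scalar multiple: `loK L j z = Lʲ•z`. [folklore] -/
private theorem loK_eq_smul (j : ℕ) (z : LSite D) : loK L j z = ((L : ℤ) ^ j) • z := by
  funext i; simp [loK]

omit [CStarAlgebra 𝔸] in
/-- the `ℓ¹` size of the double box from its corner: `|x − Lʲz|₁ ≤ (d+1)·Lʲ` for `x ∈ [Lʲz, Lʲz + (Lʲ−1)𝟙 + Lʲe_κ]`.
[cite: Balaban1985Averaging, p.24, p.25 («|Γ_{c,x}| ≤ (2d+1)L»), bookkeeping] -/
theorem l1_sub_le_of_inBox {j : ℕ} {z x : LSite D} {κ : Fin D} (hx : InBox (loK L j z) (bondHiK L j z κ) x) :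
    (l1 (x - loK L j z) : ℝ) ≤ ((D : ℝ) + 1) * (L : ℝ) ^ j := by
  have hcoord : ∀ i, (((x - loK L j z) i).natAbs : ℝ) ≤ (L : ℝ) ^ j + (if i = κ then (L : ℝ) ^ j else 0) := by
    intro i
    obtain ⟨h1, h2⟩ := hx i
    simp only [loK, bondHiK] at h1 h2
    have h0 : 0 ≤ (x - loK L j z) i := by simp only [Pi.sub_apply, loK]; linarith
    have hcast : (((x - loK L j z) i).natAbs : ℝ) = (((x - loK L j z) i : ℤ) : ℝ) := by
      rw [Nat.cast_natAbs, Int.cast_abs, abs_of_nonneg (by exact_mod_cast h0)]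
    rw [hcast]
    simp only [Pi.sub_apply, loK]
    split_ifs with hi
    · subst hi
      simp only [if_true] at h2
      have : (x i : ℝ) ≤ (L : ℝ) ^ j * z i + ((L : ℝ) ^ j - 1) + (L : ℝ) ^ j := by exact_mod_cast h2
      push_cast; linarith
    · simp only [hi, if_false, add_zero] at h2
      have : (x i : ℝ) ≤ (L : ℝ) ^ j * z i + ((L : ℝ) ^ j - 1) := by exact_mod_cast h2
      push_cast; linarith
  unfold l1
  push_cast
  calc ∑ i, (((x - loK L j z) i).natAbs : ℝ) ≤ ∑ i, ((L : ℝ) ^ j + (if i = κ then (L : ℝ) ^ j else 0)) := Finset.sum_le_sum fun i _ => hcoord i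
    _ = ((D : ℝ) + 1) * (L : ℝ) ^ j := by
        rw [Finset.sum_add_distrib, Finset.sum_const, Finset.card_univ, Fintype.card_fin, Finset.sum_ite_eq' Finset.univ κ,
          if_pos (Finset.mem_univ _), nsmul_eq_mul]
        ring

omit [CStarAlgebra 𝔸] in
/-- rotating a single-bond bump bondwise rotates its value: `R(u)·(X·δ_{(y,μ)}) = (R(u(y))X)·δ_{(y,μ)}`. [cite: Balaban1985BackgroundPropagators, (3.28) p.395, bookkeeping] -/
theorem rotate_bump {𝔹 : Type*} [NormedRing 𝔹] (u : LSite D → 𝔹ˣ) (y : LSite D) (μ : Fin D) (X : 𝔹) :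
    (fun x κ => conjR (u x) (bump y μ X x κ)) = bump y μ (conjR (u y) X) := by
  funext x κ
  by_cases h : x = y ∧ κ = μ
  · obtain ⟨rfl, rfl⟩ := h
    simp [bump]
  · rw [bump_eq_zero_of X h, bump_eq_zero_of _ h]
    simp [conjR_apply]

variable [Nontrivial 𝔸]

/-- transport by a unitary does not increase the norm. [cite: Balaban1985Averaging, p.18 («U(N)»), folklore] -/
theorem norm_conjR_le_of_unitary {T : 𝔸ˣ} (hT : T ∈ unitaryUnits 𝔸) (X : 𝔸) : ‖conjR T X‖ ≤ ‖X‖ :=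
  norm_conjR_le (B7Prop2Explicit.unitaryUnits_le_U1 hT) X

/-- **THE CLAMPED BACKGROUND** `π^*U₀` of a unitary `U₀` in the class (1.7) up to level `n` at the double box of a level-`n` bond is unitary, GLOBALLY
`αL^{−2n}`-regular, and agrees with `U₀` on the box (the `B8Eq156KLevelLocal.eq156_loc` device, as in `B9Eq316AveragingTransposeZd`).
[cite: Balaban1985Averaging, p.24 (locality), Prop. 1 (51) p.26; Balaban1985RegularSpaces, (1.7) p.77] -/
theorem clamp_regular (hL : 1 ≤ L) {n : ℕ} {α : ℝ} (hα : 0 < α) {U₀ : LSite D → Fin D → 𝔸ˣ} (hU₀ : ∀ x κ, U₀ x κ ∈ unitaryUnits 𝔸)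
    (hreg : Reg17 L n (fun _ => (Set.univ : Set (LSite D))) α U₀) (w : LSite D) (κ : Fin D) :
    (∀ x ν, clampCfg (loK L n w) (bondHiK L n w κ) U₀ x ν ∈ unitaryUnits 𝔸) ∧
      pdev (clampCfg (loK L n w) (bondHiK L n w κ) U₀) < α * (((L : ℝ) ^ n)⁻¹) ^ 2 ∧
      AgreeOn (loK L n w) (bondHiK L n w κ) (clampCfg (loK L n w) (bondHiK L n w κ) U₀) U₀ := by
  have hU₀U1 : ∀ x μ, U₀ x μ ∈ U1 𝔸 := fun x μ => B7Prop2Explicit.unitaryUnits_le_U1 (hU₀ x μ)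
  have hL0 : (0 : ℝ) < L := by exact_mod_cast hL
  refine ⟨clampCfg_mem hU₀, ?_, clampCfg_agree U₀⟩
  have hpdOn : pdevOn (loK L n w) (bondHiK L n w κ) U₀ < α * (((L : ℝ) ^ n)⁻¹) ^ 2 := by
    refine pdevOn_lt_of_forall (by positivity) fun x μ ν _ _ => ?_
    rcases eq_or_ne μ ν with rfl | hμν
    · rw [hol_plaqWord_self, Units.val_one, sub_self, norm_zero]; positivity
    · exact hreg n le_rfl x μ ν hμν (Or.inl (Set.mem_univ _))
  exact (pdev_clampCfg_le (loK_le_bondHiK L hL n w κ) hU₀U1).trans_lt hpdOn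

end Toolkit

/-! ## §2 The column theorem -/

section Column

variable [Nontrivial 𝔸] {L : ℕ} (hL : 2 ≤ L) (hD : 1 ≤ D) {n : ℕ} {α : ℝ} (hα : 0 < α) (hαQ : α ≤ alphaQ D L)
  {U₀ : LSite D → Fin D → 𝔸ˣ} (hU₀ : ∀ x κ, U₀ x κ ∈ unitaryUnits 𝔸) (hreg : Reg17 L n (fun _ => (Set.univ : Set (LSite D))) α U₀)

include hL hD hα hαQ hU₀ hreg in
/-- ★★★ **THE COLUMN THEOREM — THE KNIT's COLUMN IS THE FLAT COLUMN OF THE CORNER-TRANSPORTED VALUE, UP TO `C(d,L)·α·Lⁿ·L^{−nd}`.**  For `L ≥ 2`,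
`d ≥ 1`, `0 < α ≤ α_Q(d,L)`, a unitary `U₀` in print's class (1.7) up to level `n` on `ℤᵈ` (`Reg17 L n ℤᵈ α`), a level-`n` bond `(w, κ)` with box corner
`x₀ = Lⁿw`, a fine bond `(y, μ)` and `X`:
`‖LⁿQ_n(U₀)(X·δ_{(y,μ)})(w,κ) − LⁿQ_n(1)((R(U₀(Γ^{tree}_{x₀,y}))X)·δ_{(y,μ)})(w,κ)‖ ≤ K(d,L)·α·Lⁿ·L^{−nd}·‖X‖`, `K(d,L) = 4d·L^d·(3200(d+1)²(d+4)L³ +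
(128d² + 8d(d+1))(d+1)L³L^{−(d+1)})`.  Proof: clamp (`clamp_regular`, locality `linCovIter_congr'`), axial gauge from `x₀` (`axialFn`, `u(x₀) = 1`,
`axial_bond_bound` ⟹ `‖U₁^u(b) − 1‖ ≤ (d+1)αL^{−n}` on the box), exact covariance `linCovIter_rot` (the rotated bump is `(R(u(y))X)·δ_b`, `rotate_bump`),
clamp, and F1's flatness estimate with `ρ = (d+1)αL^{−n}`. [cite: Balaban1985Averaging, (139)–(147) pp.39–40, (11) p.19, pp.24–25; Balaban1985BackgroundPropagators, (3.28), (3.32) p.395] -/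
theorem norm_linCovIter_bump_sub_linQIter_rot_le (w : LSite D) (κ : Fin D) (y : LSite D) (μ : Fin D) (X : 𝔸) :
    ‖linCovIter L U₀ (bump y μ X) n w κ -
        linQIter L (bump y μ (conjR (hol U₀ (loK L n w) (treeWord (y - loK L n w))) X)) n w κ‖ ≤
      4 * D * (L : ℝ) ^ D *
        ((3200 * ((D : ℝ) + 1) ^ 2 * ((D : ℝ) + 4) * (L : ℝ) ^ 3 + 128 * (D : ℝ) ^ 2 * ((D : ℝ) + 1) * ((L : ℝ) ^ 3 * ((L : ℝ) ^ (D + 1))⁻¹)) +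
          8 * D * ((D : ℝ) + 1) * ((L : ℝ) ^ 3 * ((L : ℝ) ^ (D + 1))⁻¹) * ((D : ℝ) + 1)) * α *
        ((L : ℝ) ^ n * (((L : ℝ) ^ n) ^ D)⁻¹) * ‖X‖ := by
  have hL1 : 1 ≤ L := le_trans (by norm_num) hL
  have hL0 : (0 : ℝ) < L := by exact_mod_cast (lt_of_lt_of_le (by norm_num) hL)
  set lo := loK L n w with hlo
  set hi := bondHiK L n w κ with hhi
  set T : 𝔸ˣ := hol U₀ lo (treeWord (y - lo)) with hT
  -- the right-hand side is nonnegative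
  have hRHS : 0 ≤ 4 * D * (L : ℝ) ^ D *
      ((3200 * ((D : ℝ) + 1) ^ 2 * ((D : ℝ) + 4) * (L : ℝ) ^ 3 + 128 * (D : ℝ) ^ 2 * ((D : ℝ) + 1) * ((L : ℝ) ^ 3 * ((L : ℝ) ^ (D + 1))⁻¹)) +
        8 * D * ((D : ℝ) + 1) * ((L : ℝ) ^ 3 * ((L : ℝ) ^ (D + 1))⁻¹) * ((D : ℝ) + 1)) * α *
      ((L : ℝ) ^ n * (((L : ℝ) ^ n) ^ D)⁻¹) * ‖X‖ := by positivity
  -- off the box both columns vanish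
  by_cases hy : InBox lo hi y
  swap
  · rw [linCovIter_bump_eq_zero_of_not_inBox L hL1 U₀ hy μ X]
    have h1 := congrFun (congrFun (linCovIter_one_eq_linQIter hL1 (bump y μ (conjR T X)) (norm_nonneg _)
      (fun x κ' => norm_bump_le y μ _ x κ') n) w) κ
    rw [← h1, linCovIter_bump_eq_zero_of_not_inBox L hL1 _ hy μ, sub_zero, norm_zero]
    exact hRHS
  -- (i) clamp
  obtain ⟨hU₁, hpd₁, hag₁⟩ := clamp_regular L hL1 hα hU₀ hreg w κ
  set U₁ := clampCfg lo hi U₀ with hU₁def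
  have hU₁U1 : ∀ x ν, U₁ x ν ∈ U1 𝔸 := fun x ν => B7Prop2Explicit.unitaryUnits_le_U1 (hU₁ x ν)
  have e1 : linCovIter L U₀ (bump y μ X) n w κ = linCovIter L U₁ (bump y μ X) n w κ :=
    linCovIter_congr' L hL1 n w κ hag₁.symm (fun _ _ _ _ => rfl)
  -- (ii) the axial gauge from the corner
  set u : LSite D → 𝔸ˣ := axialFn U₁ lo with hu
  have hu_mem : ∀ x, u x ∈ unitaryUnits 𝔸 := fun x => B7Prop2Explicit.hol_mem_of hU₁ _ _
  have hu_U1 : ∀ x, u x ∈ U1 𝔸 := fun x => B7Prop2Explicit.unitaryUnits_le_U1 (hu_mem x)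
  have hu0 : u lo = 1 := by simp [hu, axialFn]
  have huy : u y = T := by
    rw [hT, hu]
    show hol U₁ lo (treeWord (y - lo)) = hol U₀ lo (treeWord (y - lo))
    exact hol_treeWord_congr hag₁ lo (y - lo) (loK_inBox L hL1 n w κ) (by rw [add_sub_cancel]; exact hy)
  set V₁ := gaugeAct u U₁ with hV₁
  have hV₁mem : ∀ x ν, V₁ x ν ∈ unitaryUnits 𝔸 := gaugeAct_mem_of hU₁ hu_mem
  have hV₁U1 : ∀ x ν, V₁ x ν ∈ U1 𝔸 := fun x ν => B7Prop2Explicit.unitaryUnits_le_U1 (hV₁mem x ν)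
  have hpdV₁ : pdev V₁ < α * (((L : ℝ) ^ n)⁻¹) ^ 2 := by rw [hV₁, pdev_gaugeAct hu_U1]; exact hpd₁
  have e2 : linCovIter L U₁ (bump y μ X) n w κ = linCovIter L V₁ (bump y μ (conjR T X)) n w κ := by
    have h := linCovIter_rot L u U₁ (bump y μ X) n w κ
    rw [rotate_bump, uLev_apply, ← loK_eq_smul, hu0, huy] at h
    rw [← hV₁] at h
    rw [h]
    simp [conjR_apply]
  -- the gauged field is bondwise close to `1` on the box
  have hclose₁ : ∀ x ν, InBox lo hi x → ‖((V₁ x ν : 𝔸ˣ) : 𝔸) - 1‖ ≤ ((D : ℝ) + 1) * α * ((L : ℝ) ^ n)⁻¹ := by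
    intro x ν hx
    have h44 : ∀ (x : LSite D) (κ μ : Fin D), κ ≠ μ → ‖((hol U₁ x (plaqWord κ μ) : 𝔸ˣ) : 𝔸) - 1‖ ≤ α * (((L : ℝ) ^ n)⁻¹) ^ 2 :=
      fun x κ μ _ => (le_pdev hU₁U1 x κ μ).trans hpd₁.le
    have h := axial_bond_bound U₁ hU₁U1 lo h44 (by positivity) x ν
    refine h.trans ?_
    have hl1 := l1_sub_le_of_inBox L hx
    have hLn : (0 : ℝ) < (L : ℝ) ^ n := by positivity
    calc (l1 (x - lo) : ℝ) * (α * (((L : ℝ) ^ n)⁻¹) ^ 2) ≤ ((D : ℝ) + 1) * (L : ℝ) ^ n * (α * (((L : ℝ) ^ n)⁻¹) ^ 2) :=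
          mul_le_mul_of_nonneg_right hl1 (by positivity)
      _ = ((D : ℝ) + 1) * α * ((L : ℝ) ^ n)⁻¹ := by field_simp
  -- (iii) clamp again
  set V := clampCfg lo hi V₁ with hVdef
  have hVmem : ∀ x ν, V x ν ∈ unitaryUnits 𝔸 := clampCfg_mem hV₁mem
  have hagV : AgreeOn lo hi V V₁ := clampCfg_agree V₁
  have hpdV : pdev V < α * (((L : ℝ) ^ n)⁻¹) ^ 2 := by
    have hOn : pdevOn lo hi V₁ < α * (((L : ℝ) ^ n)⁻¹) ^ 2 :=
      pdevOn_lt_of_forall (by positivity) fun x μ' ν' _ _ => (le_pdev hV₁U1 x μ' ν').trans_lt hpdV₁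
    exact (pdev_clampCfg_le (loK_le_bondHiK L hL1 n w κ) hV₁U1).trans_lt hOn
  have hρ : ∀ x ν, ‖((V x ν : 𝔸ˣ) : 𝔸) - 1‖ ≤ ((D : ℝ) + 1) * α * ((L : ℝ) ^ n)⁻¹ := by
    intro x ν
    show ‖((clampCfg lo hi V₁ x ν : 𝔸ˣ) : 𝔸) - 1‖ ≤ _
    unfold clampCfg
    split_ifs with hc
    · exact hclose₁ _ ν (clamp_inBox (loK_le_bondHiK L hL1 n w κ) x)
    · rw [Units.val_one, sub_self, norm_zero]; positivity
  have e3 : linCovIter L V₁ (bump y μ (conjR T X)) n w κ = linCovIter L V (bump y μ (conjR T X)) n w κ :=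
    linCovIter_congr' L hL1 n w κ hagV.symm (fun _ _ _ _ => rfl)
  -- F1's flatness estimate at `V`
  have hflat := norm_linCovIter_bump_sub_linQIter_le hL hD hα hαQ hVmem hpdV hρ (by positivity) y μ (conjR T X) w κ
  have hTX : ‖conjR T X‖ ≤ ‖X‖ := norm_conjR_le (hol_mem (fun x ν => B7Prop2Explicit.unitaryUnits_le_U1 (hU₀ x ν)) _ _) X
  rw [e1, e2, e3]
  refine hflat.trans ?_
  have hLn : (0 : ℝ) < (L : ℝ) ^ n := by positivity
  have hρn : (L : ℝ) ^ n * (((D : ℝ) + 1) * α * ((L : ℝ) ^ n)⁻¹) = ((D : ℝ) + 1) * α := by field_simp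
  rw [hρn]
  have hK0 : 0 ≤ 4 * D * (L : ℝ) ^ D *
      ((3200 * ((D : ℝ) + 1) ^ 2 * ((D : ℝ) + 4) * (L : ℝ) ^ 3 + 128 * (D : ℝ) ^ 2 * ((D : ℝ) + 1) * ((L : ℝ) ^ 3 * ((L : ℝ) ^ (D + 1))⁻¹)) * α +
        8 * D * ((D : ℝ) + 1) * ((L : ℝ) ^ 3 * ((L : ℝ) ^ (D + 1))⁻¹) * (((D : ℝ) + 1) * α)) *
      ((L : ℝ) ^ n * (((L : ℝ) ^ n) ^ D)⁻¹) := by positivity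
  calc _ ≤ 4 * D * (L : ℝ) ^ D *
        ((3200 * ((D : ℝ) + 1) ^ 2 * ((D : ℝ) + 4) * (L : ℝ) ^ 3 + 128 * (D : ℝ) ^ 2 * ((D : ℝ) + 1) * ((L : ℝ) ^ 3 * ((L : ℝ) ^ (D + 1))⁻¹)) * α +
          8 * D * ((D : ℝ) + 1) * ((L : ℝ) ^ 3 * ((L : ℝ) ^ (D + 1))⁻¹) * (((D : ℝ) + 1) * α)) *
        ((L : ℝ) ^ n * (((L : ℝ) ^ n) ^ D)⁻¹) * ‖X‖ := mul_le_mul_of_nonneg_left hTX hK0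
    _ = _ := by ring

end Column

/-! ## §3 The row theorem: a whole field on the double box -/

section Row

variable [Nontrivial 𝔸] {L : ℕ} (hL : 2 ≤ L) (hD : 1 ≤ D) {n : ℕ} {α : ℝ} (hα : 0 < α) (hαQ : α ≤ alphaQ D L)
  {U₀ : LSite D → Fin D → 𝔸ˣ} (hU₀ : ∀ x κ, U₀ x κ ∈ unitaryUnits 𝔸) (hreg : Reg17 L n (fun _ => (Set.univ : Set (LSite D))) α U₀)

omit [Nontrivial 𝔸] in
/-- the restriction of a bond field to a finite bond set is the finite sum of its single-bond bumps. [folklore] -/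
private theorem insCfg_restr_eq_sum (S : Finset (LSite D × Fin D)) (B : LSite D → Fin D → 𝔸) :
    insCfg S (restr S B) = (0 : LSite D → Fin D → 𝔸) + ∑ s ∈ S, (1 : ℂ) • bump s.1 s.2 (B s.1 s.2) := by
  classical
  funext x κ
  rw [zero_add, Finset.sum_apply, Finset.sum_apply]
  simp only [Pi.smul_apply, one_smul, bump, insCfg, restr]
  by_cases h : (x, κ) ∈ S
  · rw [dif_pos h, Finset.sum_eq_single (x, κ)]
    · simp
    · rintro ⟨x', κ'⟩ _ hne
      rw [if_neg]
      rintro ⟨rfl, rfl⟩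
      exact hne rfl
    · intro hn; exact absurd h hn
  · rw [dif_neg h]
    symm
    refine Finset.sum_eq_zero fun s hs => ?_
    rw [if_neg]
    rintro ⟨rfl, rfl⟩
    exact h hs

include hL hD hα hαQ hU₀ hreg in
/-- ★★ **THE ROW THEOREM — THE COMPOSITE AVERAGING OF A FIELD AT A CURVED BACKGROUND IS THE FLAT AVERAGE OF THE CORNER-TRANSPORTED FIELD, UP TO
`2d·K(d,L)·α·Lⁿ·sup|B|`.**  For `U₀`, `α`, `(w, κ)`, `x₀ = Lⁿw` as in the column theorem and a bond field `B` with `‖B(b)‖ ≤ b` on the double box: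
`‖LⁿQ_n(U₀)B(w,κ) − Σ_{b ⊂ box} LⁿQ_n(1)((R(U₀(Γ^{tree}_{x₀,b₋}))B(b))·δ_b)(w,κ)‖ ≤ 2d·K(d,L)·α·Lⁿ·b` — locality + additivity of the composite at the
clamped (globally regular) background over the `≤ 2d·L^{nd}` bonds of the box (`B7Prop5LineDerivFiniteFamily.linCovIter_family`, `hadd_levels` ∕
`hsmul_levels`) + the column theorem bond by bond. [cite: Balaban1985Averaging, (141)–(147) pp.39–40, (122) p.36, p.24] -/
theorem norm_linCovIter_sub_sum_linQIter_rot_le (w : LSite D) (κ : Fin D) (B : LSite D → Fin D → 𝔸) {b : ℝ} (hb : 0 ≤ b)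
    (hB : ∀ x ν, BondIn (loK L n w) (bondHiK L n w κ) x ν → ‖B x ν‖ ≤ b) :
    ‖linCovIter L U₀ B n w κ -
        ∑ s ∈ bondsIn (loK L n w) (bondHiK L n w κ),
          linQIter L (bump s.1 s.2 (conjR (hol U₀ (loK L n w) (treeWord (s.1 - loK L n w))) (B s.1 s.2))) n w κ‖ ≤
      2 * D * (4 * D * (L : ℝ) ^ D *
        ((3200 * ((D : ℝ) + 1) ^ 2 * ((D : ℝ) + 4) * (L : ℝ) ^ 3 + 128 * (D : ℝ) ^ 2 * ((D : ℝ) + 1) * ((L : ℝ) ^ 3 * ((L : ℝ) ^ (D + 1))⁻¹)) +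
          8 * D * ((D : ℝ) + 1) * ((L : ℝ) ^ 3 * ((L : ℝ) ^ (D + 1))⁻¹) * ((D : ℝ) + 1))) * α * (L : ℝ) ^ n * b := by
  classical
  have hL1 : 1 ≤ L := le_trans (by norm_num) hL
  have hL0 : (0 : ℝ) < L := by exact_mod_cast (lt_of_lt_of_le (by norm_num) hL)
  set lo := loK L n w with hlo
  set hi := bondHiK L n w κ with hhi
  set S := bondsIn lo hi with hS
  set K : ℝ := 4 * D * (L : ℝ) ^ D *
        ((3200 * ((D : ℝ) + 1) ^ 2 * ((D : ℝ) + 4) * (L : ℝ) ^ 3 + 128 * (D : ℝ) ^ 2 * ((D : ℝ) + 1) * ((L : ℝ) ^ 3 * ((L : ℝ) ^ (D + 1))⁻¹)) +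
          8 * D * ((D : ℝ) + 1) * ((L : ℝ) ^ 3 * ((L : ℝ) ^ (D + 1))⁻¹) * ((D : ℝ) + 1)) with hK
  have hK0 : 0 ≤ K := by positivity
  set lam : ℝ := (L : ℝ) ^ n * (((L : ℝ) ^ n) ^ D)⁻¹ with hlam
  -- clamp and decompose the restriction into bumps
  obtain ⟨hU₁, hpd₁, hag₁⟩ := clamp_regular L hL1 hα hU₀ hreg w κ
  set U₁ := clampCfg lo hi U₀ with hU₁def
  obtain ⟨hα3, -, -⟩ := windows_of_alphaQ (D := D) hL hD hα hαQ
  have hα4 : 4 * α ≤ c2' D L := by have := four_mul_alphaQ_le D L; linarith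
  have hG := avgClosed_unitaryUnits (𝔸 := 𝔸) D L
  have hadd := hadd_levels L hL hG n U₁ hU₁ hα hα3 hα4 hpd₁
  have hsmul := hsmul_levels L hL hG n U₁ hU₁ hα hα3 hα4 hpd₁
  have e1 : linCovIter L U₀ B n w κ = ∑ s ∈ S, linCovIter L U₀ (bump s.1 s.2 (B s.1 s.2)) n w κ := by
    have hloc : linCovIter L U₀ B n w κ = linCovIter L U₁ (insCfg S (restr S B)) n w κ :=
      linCovIter_congr' L hL1 n w κ hag₁.symm (agreeOn_insCfg_restr _ _ B)
    rw [hloc, insCfg_restr_eq_sum S B,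
      linCovIter_family L U₁ n hadd hsmul S (fun _ => (1 : ℂ)) (fun s => bump s.1 s.2 (B s.1 s.2)) 0 n le_rfl w κ,
      linCovIter_zero_field, Pi.zero_apply, Pi.zero_apply, zero_add]
    refine Finset.sum_congr rfl fun s _ => ?_
    rw [one_smul]
    exact linCovIter_congr' L hL1 n w κ hag₁ (fun _ _ _ _ => rfl)
  rw [e1, ← Finset.sum_sub_distrib]
  -- column theorem bond by bond
  have hcol : ∀ s ∈ S, ‖linCovIter L U₀ (bump s.1 s.2 (B s.1 s.2)) n w κ -
      linQIter L (bump s.1 s.2 (conjR (hol U₀ lo (treeWord (s.1 - lo))) (B s.1 s.2))) n w κ‖ ≤ K * α * lam * b := by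
    intro s hs
    have h := norm_linCovIter_bump_sub_linQIter_rot_le hL hD hα hαQ hU₀ hreg w κ s.1 s.2 (B s.1 s.2)
    refine h.trans ?_
    rw [← hK]
    exact mul_le_mul_of_nonneg_left (hB s.1 s.2 (mem_bondsIn.1 hs)) (by positivity)
  have hcard : (S.card : ℝ) ≤ 2 * ((L : ℝ) ^ n) ^ D * D := by
    have h1 := card_bondsIn_le lo hi
    rw [hlo, hhi, card_boxFinset_K] at h1
    have : (S.card : ℝ) ≤ ((2 * (L ^ n) ^ D * D : ℕ) : ℝ) := by rw [hS, hlo, hhi]; exact_mod_cast h1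
    simpa using this
  calc ‖∑ s ∈ S, (linCovIter L U₀ (bump s.1 s.2 (B s.1 s.2)) n w κ -
          linQIter L (bump s.1 s.2 (conjR (hol U₀ lo (treeWord (s.1 - lo))) (B s.1 s.2))) n w κ)‖
      ≤ ∑ s ∈ S, K * α * lam * b := (norm_sum_le _ _).trans (Finset.sum_le_sum hcol)
    _ = S.card * (K * α * lam * b) := by rw [Finset.sum_const, nsmul_eq_mul]
    _ ≤ (2 * ((L : ℝ) ^ n) ^ D * D) * (K * α * lam * b) := mul_le_mul_of_nonneg_right hcard (by positivity)
    _ = 2 * D * K * α * (L : ℝ) ^ n * b := by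
        have hP : ((L : ℝ) ^ n) ^ D ≠ 0 := by positivity
        rw [hlam]
        field_simp

end Row

end Literature.MathematicalPhysics.QuantumFieldTheory.Balaban1983to89.B9B8KnitColumnGauge
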